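import Summits.ResolutionOfSingularities.ResolutionOfSingularities.Theorems.PurelyInseparableDim4PointChainAcc
import HarnessLib

/-!
# Purely inseparable four-folds: ZIGZAG charts `Z ← Y → 𝔸⁵` for the point-centre walk — orders, admissibility, and
# SURVIVAL of a chart under a blow-up away from its point (brick TY-3k part 1, cell `res-dim4-pi`)

[OURS · counted 0] (D-0157 DOOR 2; first piece of the FINITE-TREE assembly (several isolated order-`p` points per
stage) of `PIDim4.TerminationImpliesOrderReduction` (typ-3 memo §D (d1)); host item stmt-ResolutionOfSingularities-16155,
helper). Nothing here proves resolution of singularities in dimension ≥ 4 / characteristic `p`.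

The single-point chain (`…PointChainAcc`) carries a FULL affine chart `φ : 𝔸⁵_K ⟶ Z` at the one order-`p` point. With
SEVERAL closed order-`p` points per stage a full chart at `x₂` may pass through the blown-up point `x₁` and does not
survive the blow-up. What survives is a ZIGZAG chart: a scheme `Y` with open immersions `φ : Y ⟶ Z`, `ψ : Y ⟶ 𝔸⁵_K`
and a point `y` with `φ y = x₀`, `ψ y = ξ` (origin), under which the ideal reads `M.ideal|_Y = (z^p + F)·𝒪|_Y`
(`M.ideal.comap φ = (hypSheaf p F).comap ψ`) — an open piece of `𝔸⁵_K` around the origin, openly embedded in `Z`.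

* `le_idealOrder_of_zigzag`, `support_vanishingIdeal_subset_support_of_zigzag`, `isMultipleBlowup_extend_point_of_zigzag`
  — a zigzag chart with `p ≤ ord₀ F` puts `x₀` in `supp M`, so blowing up `x₀` extends an admissible sequence
  (BGMW Def. 3.1.3, as `…PointChain.isMultipleBlowup_extend_point` for full charts);
* `exists_eq_of_not_mem_support`, `eq_of_eq_of_not_mem_support`, `isClosed_singleton_of_not_mem_support` (and the
  `…_of_mem_of_disjoint` forms over an open `O` disjoint from the centre) — points of a blowing up OFF its centre:
  unique preimages, closed over closed (Stacks 02OS: the blow-up is an isomorphism over the complement of the centre);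
* `controlledTransform_top` — with the unit ideal as centre the controlled transform is the total transform;
* **`exists_zigzag_comap_controlledTransform_of_not_mem_support`** — SURVIVAL: a zigzag chart at a point `x₀` OFF the
  centre of a blowing up `π : W → Z` induces a zigzag chart at the point `w` over `x₀`, under which the controlled
  transform reads as the SAME model ideal (shrink `Y` to `φ⁻¹(Z ∖ V(C))`, invert `π` there).

Part 2 (the zigzag STEP PACKAGE over the blown-up point, via `IsBlowup.unique`) and part 3 (the finite-tree induction,
Dershowitz–Manna / `Relation.CutExpand` on the multiset of states) follow.
AI-produced formalisation, weaker than expert review. bears_on: LADDER-RESOLUTION:D157-DOOR2 (res-dim4-pi · TY-3k).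
-/

set_option linter.dupNamespace false -- D-0017: single-problem summit path `Summit.<S>.<S>.…` by design

noncomputable section

universe u

open MvPolynomial Finset CategoryTheory AlgebraicGeometry Opposite TopologicalSpace

namespace Summit.ResolutionOfSingularities.ResolutionOfSingularities.Theorems.PIDim4

open Literature.AlgebraicGeometry.Resolution
open Literature.AlgebraicGeometry.Resolution.Hauser2010
open Literature.AlgebraicGeometry.Resolution.AffinePointBlowup (P A γ coord Wtop ξ)

namespace Equimultiple

/-! ## 1. Zigzag charts: the point lies in the support; blowing it up is admissible -/

section Zigzag

variable {K : Type} [Field K] {p : ℕ} [hp : Fact p.Prime] [CharP K p]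
variable {Z Y : Scheme.{0}} {x₀ : Z}

/-- **The point of a zigzag chart lies in the order-`p` locus**: if `M.ideal|_Y = (z^p + F)·𝒪|_Y` along open immersions
`φ : Y ⟶ Z`, `ψ : Y ⟶ 𝔸⁵_K` with `φ y = x₀`, `ψ y = ξ`, and `p ≤ ord₀ F`, then `ord_{x₀} M.ideal ≥ p` (orders are read
along open immersions, BGMW Lemma 8.0.3 (2)). [cite: BierstoneGrigorievMilmanWlodarczyk2011, Lemma 8.0.3 (2)]
[cite: Hauser2010, §F] -/
theorem le_idealOrder_of_zigzag [DecidableEq K] (φ : Y ⟶ Z) [IsOpenImmersion φ] (ψ : Y ⟶ P 4 K) [IsOpenImmersion ψ]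
    (y : Y) (hφ : φ y = x₀) (hψ : ψ y = ξ 4 K) (M : MarkedIdeal Z) (s : State K)
    (hM : M.ideal.comap φ = (hypSheaf p s.F).comap ψ)
    (hperm : (p : ℕ∞) ≤ CentreBlowup.ordAlong (Finset.univ : Finset (Fin 4)) s.F) :
    (p : ℕ∞) ≤ idealOrder M.ideal x₀ := by
  rw [← hφ, ← idealOrder_comap_of_isOpenImmersion φ M.ideal y, hM, idealOrder_comap_of_isOpenImmersion ψ _ y, hψ]
  exact le_idealOrder_of_chart (𝟙 (P 4 K)) rfl (⟨hypSheaf p s.F, [], p⟩ : MarkedIdeal (P 4 K)) s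
    (Scheme.IdealSheafData.comap_id _) hperm

/-- `{x₀} ⊆ supp M` for the point of a zigzag chart. [cite: BierstoneGrigorievMilmanWlodarczyk2011, Def. 3.1.3 (3)] -/
theorem support_vanishingIdeal_subset_support_of_zigzag [IsLocallyNoetherian Z] [DecidableEq K] (φ : Y ⟶ Z)
    [IsOpenImmersion φ] (ψ : Y ⟶ P 4 K) [IsOpenImmersion ψ] (y : Y) (hx₀ : IsClosed ({x₀} : Set Z)) (hφ : φ y = x₀)
    (hψ : ψ y = ξ 4 K) (M : MarkedIdeal Z) (hmult : M.mult = p) (s : State K)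
    (hM : M.ideal.comap φ = (hypSheaf p s.F).comap ψ)
    (hperm : (p : ℕ∞) ≤ CentreBlowup.ordAlong (Finset.univ : Finset (Fin 4)) s.F) :
    ((Scheme.IdealSheafData.vanishingIdeal (⟨{x₀}, hx₀⟩ : Closeds Z)).support : Set Z) ⊆ M.support := by
  intro z hz
  obtain rfl : z = x₀ := (mem_support_vanishingIdeal_singleton_iff hx₀).mp hz
  change (M.mult : ℕ∞) ≤ idealOrder M.ideal z
  rw [hmult]
  exact le_idealOrder_of_zigzag φ ψ y hφ hψ M s hM hperm

variable {X : Scheme.{0}} {σ : Z ⟶ X} {W : Scheme.{0}} {π : W ⟶ Z}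

/-- **EXTEND an admissible sequence by the point blow-up at the point of a zigzag chart** (BGMW Def. 3.1.3 (1)–(5):
a closed point of `supp M'` is a regular centre with snc with every snc boundary).
[cite: BierstoneGrigorievMilmanWlodarczyk2011, Def. 3.1.3] -/
theorem isMultipleBlowup_extend_point_of_zigzag [IsLocallyNoetherian X] [DecidableEq K] {M : MarkedIdeal X}
    {M' : MarkedIdeal Z} (h : IsMultipleBlowup M σ M') (hE : HasSNC M.boundary) (hmult : M.mult = p)
    (φ : Y ⟶ Z) [IsOpenImmersion φ] (ψ : Y ⟶ P 4 K) [IsOpenImmersion ψ] (y : Y) (hx₀ : IsClosed ({x₀} : Set Z))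
    (hφ : φ y = x₀) (hψ : ψ y = ξ 4 K) (s : State K) (hM' : M'.ideal.comap φ = (hypSheaf p s.F).comap ψ)
    (hperm : (p : ℕ∞) ≤ CentreBlowup.ordAlong (Finset.univ : Finset (Fin 4)) s.F)
    (hπ : IsBlowup π (Scheme.IdealSheafData.vanishingIdeal (⟨{x₀}, hx₀⟩ : Closeds Z))) :
    IsMultipleBlowup M (π ≫ σ) (M'.transform π (Scheme.IdealSheafData.vanishingIdeal (⟨{x₀}, hx₀⟩ : Closeds Z))) := by
  haveI := h.isLocallyNoetherian
  exact IsMultipleBlowup.blowup h _ π hπ (isRegular_subscheme_vanishingIdeal_singleton hx₀)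
    (support_vanishingIdeal_subset_support_of_zigzag φ ψ y hx₀ hφ hψ M' (h.mult_eq.trans hmult) s hM' hperm)
    ((h.hasSNC_boundary hE).hasSNCWith_vanishingIdeal_singleton hx₀)

end Zigzag

/-! ## 2. Points of a blowing up off its centre -/

section OffCentre

variable {Z W : Scheme.{u}} {π : W ⟶ Z} {C : Z.IdealSheafData} {O : Z.Opens}

/-- **Over an open `O` disjoint from its centre a blowing up is surjective**: every `x ∈ O` has a preimage
(`π⁻¹(O) ≅ O`, Stacks 02OS). [cite: StacksProject, Tag 02OS] -/
theorem exists_eq_of_mem_of_disjoint (hπ : IsBlowup π C) (hO : Disjoint (O : Set Z) C.support) {x : Z}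
    (hx : x ∈ O) : ∃ w : W, π w = x := by
  haveI : IsIso (π ∣_ O) := hπ.isIso_morphismRestrict hO
  refine ⟨(π ⁻¹ᵁ O).ι (inv (π ∣_ O) ⟨x, hx⟩), ?_⟩
  have h1 : (π ∣_ O) (inv (π ∣_ O) ⟨x, hx⟩) = ⟨x, hx⟩ := by
    rw [← Scheme.Hom.comp_apply, IsIso.inv_hom_id]
    rfl
  rw [← ι_morphismRestrict_apply, h1]
  rfl

/-- **Over an open `O` disjoint from its centre a blowing up is injective**: two points with the same image in `O`
are equal. [cite: StacksProject, Tag 02OS] -/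
theorem eq_of_eq_of_mem_of_disjoint (hπ : IsBlowup π C) (hO : Disjoint (O : Set Z) C.support) {w w' : W}
    (he : π w = π w') (hx : π w ∈ O) : w = w' := by
  haveI : IsIso (π ∣_ O) := hπ.isIso_morphismRestrict hO
  have hw : w ∈ π ⁻¹ᵁ O := hx
  have hw' : w' ∈ π ⁻¹ᵁ O := by
    change π w' ∈ O
    rw [← he]
    exact hx
  have key : (π ∣_ O) ⟨w, hw⟩ = (π ∣_ O) ⟨w', hw'⟩ := by
    apply Subtype.ext
    rw [morphismRestrict_base_coe, morphismRestrict_base_coe]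
    exact he
  exact congrArg Subtype.val ((π ∣_ O).isOpenEmbedding.injective key)

/-- **Unique preimages off the centre**: two points of `W` with the same image `∉ V(C)` are equal (`O = Z ∖ V(C)`).
[cite: StacksProject, Tag 02OS] -/
theorem eq_of_eq_of_not_mem_support (hπ : IsBlowup π C) {w w' : W} (he : π w = π w')
    (hx : π w ∉ (C.support : Set Z)) : w = w' :=
  eq_of_eq_of_mem_of_disjoint hπ (O := ⟨(C.support : Set Z)ᶜ, C.support.isClosed.isOpen_compl⟩)
    disjoint_compl_left he hx

/-- **Every point off the centre has a preimage** (`O = Z ∖ V(C)`). [cite: StacksProject, Tag 02OS] -/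
theorem exists_eq_of_not_mem_support (hπ : IsBlowup π C) {x : Z} (hx : x ∉ (C.support : Set Z)) :
    ∃ w : W, π w = x :=
  exists_eq_of_mem_of_disjoint hπ (O := ⟨(C.support : Set Z)ᶜ, C.support.isClosed.isOpen_compl⟩)
    disjoint_compl_left hx

/-- **A point over a closed point off the centre is closed** (its singleton is the preimage of a closed singleton).
[cite: StacksProject, Tag 02OS] -/
theorem isClosed_singleton_of_not_mem_support (hπ : IsBlowup π C) {w : W} (hc : IsClosed ({π w} : Set Z))
    (hx : π w ∉ (C.support : Set Z)) : IsClosed ({w} : Set W) := by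
  have h : (π : W → Z) ⁻¹' {π w} = {w} := by
    ext w'
    simp only [Set.mem_preimage, Set.mem_singleton_iff]
    exact ⟨fun h => (eq_of_eq_of_not_mem_support hπ h.symm hx).symm, fun h => by rw [h]⟩
  rw [← h]
  exact hc.preimage π.continuous

omit π W in
/-- The centre restricted to an open disjoint from its support is the unit ideal. [folklore] -/
theorem comap_ι_eq_top_of_disjoint (C : Z.IdealSheafData) (hO : Disjoint (O : Set Z) C.support) :
    C.comap O.ι = ⊤ := by
  rw [← Scheme.IdealSheafData.support_eq_bot_iff, Scheme.IdealSheafData.support_comap]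
  ext x
  simp only [Closeds.coe_preimage, Set.mem_preimage, Closeds.coe_bot, Set.mem_empty_iff_false, iff_false]
  exact fun hx => Set.disjoint_left.mp hO x.2 hx

/-- **With the unit ideal as centre the controlled transform is the total transform**: `(σ^*I : ⊤^μ) = σ^*I`.
[cite: BierstoneGrigorievMilmanWlodarczyk2011, §3.2] -/
theorem controlledTransform_top {Z' : Scheme.{u}} (σ : Z' ⟶ Z) (I : Z.IdealSheafData) (μ : ℕ) :
    controlledTransform σ ⊤ I μ = I.comap σ := by
  rw [controlledTransform, Scheme.IdealSheafData.comap_top, ← Scheme.IdealSheafData.one_eq_top, one_pow,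
    Scheme.IdealSheafData.one_eq_top, colon_top]

/-- **The controlled transform over an open disjoint from the centre is the total transform**:
`τᶜ(I, μ)|_{π⁻¹(O)} = (I|_O)·𝒪_{π⁻¹ O}`. [cite: StacksProject, Tag 02OS]
[cite: BierstoneGrigorievMilmanWlodarczyk2011, §3.2] -/
theorem comap_controlledTransform_ι_of_disjoint [IsLocallyNoetherian W] (C I : Z.IdealSheafData)
    (hO : Disjoint (O : Set Z) C.support) (μ : ℕ) :
    (controlledTransform π C I μ).comap (π ⁻¹ᵁ O).ι = (I.comap O.ι).comap (π ∣_ O) := by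
  rw [← controlledTransform_morphismRestrict, comap_ι_eq_top_of_disjoint C hO, controlledTransform_top]

end OffCentre

/-! ## 3. Survival of a zigzag chart under a blowing up away from its point -/

section Survival

variable {Z W Y T : Scheme.{u}} {π : W ⟶ Z} {C : Z.IdealSheafData} {x₀ : Z}

/-- **SURVIVAL OF ZIGZAG CHARTS (open form).** Let `π : W → Z` be a blowing up along `C` (`W` locally Noetherian),
`O ⊆ Z` an open disjoint from `V(C)` and `x₀ ∈ O`. A zigzag chart at `x₀` — open immersions `φ : Y ⟶ Z`, `ψ : Y ⟶ T`,
a point `y` with `φ y = x₀`, `ψ y = t`, and ideal sheaves with `I.comap φ = J.comap ψ` — induces, at ANY `w ∈ W` over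
`x₀`, a zigzag chart `φ' : Y' ⟶ W`, `ψ' : Y' ⟶ T`, `φ' y' = w`, `ψ' y' = t`, under which the controlled transform reads
as the same model: `(πᶜ(I, μ)).comap φ' = J.comap ψ'` (`Y' = φ⁻¹(O)`, `φ' = φ|_O ≫ (π|_O)⁻¹`, Stacks 02OS).
[cite: StacksProject, Tag 02OS] [cite: BierstoneGrigorievMilmanWlodarczyk2011, §3.2 with Lemma 8.0.3 (2)] -/
theorem exists_zigzag_comap_controlledTransform_of_mem_of_disjoint [IsLocallyNoetherian W] (hπ : IsBlowup π C)
    {O : Z.Opens} (hO : Disjoint (O : Set Z) C.support) (hx₀ : x₀ ∈ O) (φ : Y ⟶ Z) [IsOpenImmersion φ]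
    (ψ : Y ⟶ T) [IsOpenImmersion ψ] (y : Y) {t : T} (hφ : φ y = x₀) (hψ : ψ y = t) (I : Z.IdealSheafData)
    (J : T.IdealSheafData) (hI : I.comap φ = J.comap ψ) (μ : ℕ) {w : W} (hw : π w = x₀) :
    ∃ (Y' : Scheme.{u}) (φ' : Y' ⟶ W) (ψ' : Y' ⟶ T) (_ : IsOpenImmersion φ') (_ : IsOpenImmersion ψ') (y' : Y'),
      φ' y' = w ∧ ψ' y' = t ∧ (controlledTransform π C I μ).comap φ' = J.comap ψ' := by
  haveI : IsIso (π ∣_ O) := hπ.isIso_morphismRestrict hO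
  have hy : y ∈ φ ⁻¹ᵁ O := by
    change φ y ∈ O
    rw [hφ]
    exact hx₀
  have hwO : w ∈ π ⁻¹ᵁ O := by
    change π w ∈ O
    rw [hw]
    exact hx₀
  refine ⟨(φ ⁻¹ᵁ O : Y.Opens), (φ ∣_ O) ≫ inv (π ∣_ O) ≫ (π ⁻¹ᵁ O).ι, (φ ⁻¹ᵁ O).ι ≫ ψ, inferInstance,
    inferInstance, ⟨y, hy⟩, ?_, ?_, ?_⟩
  · -- the point: `φ| y = x₀ = π| w`, so `(π|)⁻¹ (φ| y) = w`
    have h1 : (φ ∣_ O) ⟨y, hy⟩ = (π ∣_ O) ⟨w, hwO⟩ := by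
      apply Subtype.ext
      rw [morphismRestrict_base_coe, morphismRestrict_base_coe]
      exact hφ.trans hw.symm
    rw [Scheme.Hom.comp_apply, Scheme.Hom.comp_apply, h1, ← Scheme.Hom.comp_apply (π ∣_ O), IsIso.hom_inv_id]
    rfl
  · rw [Scheme.Hom.comp_apply]
    exact hψ
  · rw [Scheme.IdealSheafData.comap_comp, Scheme.IdealSheafData.comap_comp, comap_controlledTransform_ι_of_disjoint C I hO,
      ← Scheme.IdealSheafData.comap_comp _ (inv (π ∣_ O)), IsIso.inv_hom_id, Scheme.IdealSheafData.comap_id,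
      ← Scheme.IdealSheafData.comap_comp, morphismRestrict_ι, Scheme.IdealSheafData.comap_comp, hI,
      ← Scheme.IdealSheafData.comap_comp]

/-- **SURVIVAL OF ZIGZAG CHARTS** at a point `x₀ ∉ V(C)` (`O = Z ∖ V(C)` in the open form): at any `w` over `x₀` there
is a zigzag chart under which `πᶜ(I, μ)` reads as the same model `J`. [cite: StacksProject, Tag 02OS]
[cite: BierstoneGrigorievMilmanWlodarczyk2011, §3.2 with Lemma 8.0.3 (2)] -/
theorem exists_zigzag_comap_controlledTransform_of_not_mem_support [IsLocallyNoetherian W] (hπ : IsBlowup π C)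
    (hx₀ : x₀ ∉ (C.support : Set Z)) (φ : Y ⟶ Z) [IsOpenImmersion φ] (ψ : Y ⟶ T) [IsOpenImmersion ψ] (y : Y)
    {t : T} (hφ : φ y = x₀) (hψ : ψ y = t) (I : Z.IdealSheafData) (J : T.IdealSheafData)
    (hI : I.comap φ = J.comap ψ) (μ : ℕ) {w : W} (hw : π w = x₀) :
    ∃ (Y' : Scheme.{u}) (φ' : Y' ⟶ W) (ψ' : Y' ⟶ T) (_ : IsOpenImmersion φ') (_ : IsOpenImmersion ψ') (y' : Y'),
      φ' y' = w ∧ ψ' y' = t ∧ (controlledTransform π C I μ).comap φ' = J.comap ψ' :=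
  exists_zigzag_comap_controlledTransform_of_mem_of_disjoint hπ
    (O := ⟨(C.support : Set Z)ᶜ, C.support.isClosed.isOpen_compl⟩) disjoint_compl_left hx₀ φ ψ y hφ hψ I J hI μ hw

/-- **Orders survive too**: at `w` over `x₀ ∉ V(C)`, `ord_w πᶜ(I, μ) = ord_{x₀} I` (tree
`IsBlowup.idealOrder_controlledTransform_eq_of_not_mem`, with `π w = x₀` substituted). [cite: StacksProject, Tag 02OS] -/
theorem idealOrder_controlledTransform_eq_of_eq_of_not_mem_support (hπ : IsBlowup π C)
    (hx₀ : x₀ ∉ (C.support : Set Z)) (I : Z.IdealSheafData) (μ : ℕ) {w : W} (hw : π w = x₀) :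
    idealOrder (controlledTransform π C I μ) w = idealOrder I x₀ := by
  rw [← hw] at hx₀ ⊢
  exact hπ.idealOrder_controlledTransform_eq_of_not_mem (𝓗 := I) μ hx₀

end Survival

end Equimultiple

end Summit.ResolutionOfSingularities.ResolutionOfSingularities.Theorems.PIDim4

end
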